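import Mathlib
import HarnessLib
import Summits.HubbardSuperconductivity.HubbardSuperconductivity.Theorems.KLProgrammeKLRegimeEngineV8DefsQ7
import Summits.HubbardSuperconductivity.HubbardSuperconductivity.Theorems.KLProgrammeKLRegimeEngineV8DefsU9
import Summits.HubbardSuperconductivity.HubbardSuperconductivity.Theorems.KLProgrammeKLRegimeEngineScaleZeroKernelNormsWtDoors

/-!
# Stub (b)'s `j = 0` weighted level at the v7 package `klEngQ7` (token #12, plan g17 (R44)): the WITNESS of `WtScaleZeroAt6 klWtT` and the
# unconditional consumers

Cell `gate-hubbard-kl`, seat hubbard-kl-k3c2-p1 g4.  `…EngineV8DefsQ7` defines `klWtT` by the classical `if` over `∃ T ≥ 0, WtScaleZeroAt6 T`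
and gives the consumer form `kernelNormsWt4_zero_klWtBudget_klEngQ7_of` from any witness; p3 g9's door-keyed (E1-W)₀ export
`exists_kernelNormsWt4_zero_klWtBudget_klEng6` (`…ScaleZeroKernelNormsWtDoors`, p533570) IS such a witness (its body is `WtScaleZeroAt6 T` verbatim):

* **`exists_wtScaleZeroAt6`**, **`wtScaleZeroAt6_klWtT : WtScaleZeroAt6 klWtT`** (so `klWtT` is the honest `Classical.choose` branch);
* **`kernelNormsWt4_zero_klWtBudget_klEngQ7`** — `KernelNormsWt4 L M (klWtBudget P (klEngQ7 P R) U 0) β U μ K 0` under the engine-flow binders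
  (`c ≤ klEngC₃6 P R`, `U ≤ klEngU₀6 P R c`) for EVERY admissible frame `K` (e.g. the flow frame `K_n`), UNCONDITIONALLY;
* `kernelNormsWt4_zero_klWtBudget_klEngQ7U9` — the same under token #10 (`U ≤ klEngU₀9 P R c`).

Bookkeeping only; nothing about the model is asserted beyond the cited upstream theorems; nothing asserts superconductivity.
-/

noncomputable section

namespace Summit.HubbardSuperconductivity.HubbardSuperconductivity.Theorems.EngineV8

set_option linter.dupNamespace false -- summit = problem name (single-conjunct summit), D-0017

open Real Finset Literature.MathematicalPhysics.QuantumLattice Literature.Probability.LatticeModels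
open Summit.HubbardSuperconductivity.HubbardSuperconductivity.Theorems.KLRegimeSplit
open Summit.HubbardSuperconductivity.HubbardSuperconductivity.Theorems.KLProgrammeLegKernels

/-- **`∃ T ≥ 0, WtScaleZeroAt6 T`** — p3 g9's `exists_kernelNormsWt4_zero_klWtBudget_klEng6`, whose body is `WtScaleZeroAt6 T` verbatim. -/
theorem exists_wtScaleZeroAt6 : ∃ T : ℝ, 0 ≤ T ∧ WtScaleZeroAt6 T := exists_kernelNormsWt4_zero_klWtBudget_klEng6

/-- **`klWtT` IS admissible.** -/
theorem wtScaleZeroAt6_klWtT : WtScaleZeroAt6 klWtT := by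
  obtain ⟨T, hT0, hT⟩ := exists_wtScaleZeroAt6
  exact wtScaleZeroAt6_klWtT_of hT0 hT

/-- **Stub (b)'s `j = 0` weighted level at the v7 package, for EVERY admissible frame, UNCONDITIONALLY**: under `c ≤ klEngC₃6 P R`,
`U ≤ klEngU₀6 P R c` and `FrameOK R U (nScales β) μ K`, `KernelNormsWt4 L M (klWtBudget P (klEngQ7 P R) U 0) β U μ K 0`. -/
theorem kernelNormsWt4_zero_klWtBudget_klEngQ7 (P : SplitConsts) (R : RenConsts) (c : ℝ) (hP : P.WF) (hR : R.WF2) (hc : 0 < c)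
    (hc₆ : c ≤ klEngC₃6 P R) (μ : ℝ) (hμ : μ ∈ klWindowC) (U : ℝ) (hU : 0 < U) (hU₀ : U ≤ klEngU₀6 P R c) (β : ℝ)
    (hβ : klBetaMin ≤ β) (hβc : β ≤ Real.exp (c / U ^ 2)) (K : TrigPolyC4v) (hK : FrameOK R U (nScales β) μ K) (L M : ℕ) [NeZero L]
    [NeZero M] (hL : klEngL₃ β U ≤ L) (hM : klEngM₃ β U L ≤ M) :
    KernelNormsWt4 L M (klWtBudget P (klEngQ7 P R) U 0) β U μ K 0 :=
  kernelNormsWt4_zero_klWtBudget_klEngQ7_of klWtT_nonneg wtScaleZeroAt6_klWtT P R c hP hR hc hc₆ μ hμ U hU hU₀ β hβ hβc K hK L M hL hM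

/-- The same under token #10 (`U ≤ klEngU₀9 P R c`). -/
theorem kernelNormsWt4_zero_klWtBudget_klEngQ7U9 (P : SplitConsts) (R : RenConsts) (c : ℝ) (hP : P.WF) (hR : R.WF2) (hc : 0 < c)
    (hc₆ : c ≤ klEngC₃6 P R) (μ : ℝ) (hμ : μ ∈ klWindowC) (U : ℝ) (hU : 0 < U) (hU₀ : U ≤ klEngU₀9 P R c) (β : ℝ)
    (hβ : klBetaMin ≤ β) (hβc : β ≤ Real.exp (c / U ^ 2)) (K : TrigPolyC4v) (hK : FrameOK R U (nScales β) μ K) (L M : ℕ) [NeZero L]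
    [NeZero M] (hL : klEngL₃ β U ≤ L) (hM : klEngM₃ β U L ≤ M) :
    KernelNormsWt4 L M (klWtBudget P (klEngQ7 P R) U 0) β U μ K 0 :=
  kernelNormsWt4_zero_klWtBudget_klEngQ7 P R c hP hR hc hc₆ μ hμ U hU (hU₀.trans (klEngU₀9_le_klEngU₀6 P R c)) β hβ hβc K hK L M hL hM

end Summit.HubbardSuperconductivity.HubbardSuperconductivity.Theorems.EngineV8

end
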